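import Summits.AtomisticToContinuum.BoseEinsteinCondensation.Theses.BECProbeMassFlow
import Summits.AtomisticToContinuum.BoseEinsteinCondensation.Theorems.BECProbeMassFlowCloudMomentumAtomFreeZeroMomentum
import Summits.AtomisticToContinuum.BoseEinsteinCondensation.Theorems.BECProbeMassFlowCloudMomentumAtomProjectionTransfer
import Summits.AtomisticToContinuum.BoseEinsteinCondensation.Theorems.BECProbeMassFlowCloudMomentumAtomImpurityEnergyFinite
import Summits.AtomisticToContinuum.BoseEinsteinCondensation.Theorems.BECProbeMassFlowCloudMomentumAtomClusteringReduction
import Summits.AtomisticToContinuum.BoseEinsteinCondensation.Theorems.BECProbeMassFlowCloudMomentumAtomImpurityClusteringOfGap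
import Summits.AtomisticToContinuum.BoseEinsteinCondensation.Theorems.BECProbeMassFlowCloudMomentumAtomFreeKyFanGapLocallyBounded
import Summits.AtomisticToContinuum.BoseEinsteinCondensation.Theorems.BECProbeMassFlowCloudMomentumAtomImpurityKyFanGapIntegrable
import Summits.AtomisticToContinuum.BoseEinsteinCondensation.Theorems.BECProbeMassFlowCloudMomentumAtomForEachReduction
import HarnessLib.Audit

/-!
# Birth skeleton for crux `BECProbeMassFlow.CloudMomentumAtom` — reshaped (lead c2, v6; lead c3, v7/v8; lead c4, v9: ONE registered stub; lead c5, v10: doc only)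
(item stmt-AtomisticToContinuum-12310, route route-AtomisticToContinuum-BECProbeMassFlow;
skeleton-register seat planner-skel-stmt-AtomisticToContinuum-12310-0, 2026-08-17; published as
`Cruxes/CloudMomentumAtom/Lines/birth.lean`; reshaped by lead c1 (finiteness split; 3 stubs and the
composition landed: p143762, p144993, p147259) and by lead c2 (this file: the Anderson-fidelity stub
split into its infrared part and its fixed-`N` spectral parts).)

Crux (fixed, concluded BY NAME below): `CloudMomentumAtom` — for every repulsive finite-range `v`
and `ε > 0` there is `ρ₀ > 0` such that for `0 < ρ < ρ₀`, eventually in `N`, there is `δ > 0` with: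
every `δ`-near-minimiser `Φ` of the pinned-scatterer energy `impurityPeriodicEnergy v 0 Φ` on the
torus of side `L = sideLength ρ (N+1)` has zero-total-momentum weight
`w₀(Φ) := L⁻⁶ ∫_{cell^N} ‖∫_{cell} Φ(X + t𝟙) dt‖² dX ≥ 1 − ε`.

## The line (route's foreseen split "AndersonFidelity → ProjectionGlue → CloudMomentumAtom")

`Π₀ := L⁻³ ∫_{cell} T_t dt` projects `L²(cell^N)` onto zero TOTAL momentum, `w₀(Φ) = ‖Π₀Φ‖²`.
Geometry: `w₀(Φ) ≥ (|⟨Ψ,Φ⟩| − (1 − w₀(Ψ))^{1/2})₊²` (`stub_projectionTransfer`, LANDED p144993); free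
near-minimisers `Ψ` have `w₀(Ψ) → 1` at fixed `(N, L)` (`stub_freeZeroMomentum`, LANDED p143762,
diamagnetic sector floor `E(q) ≥ E₀ + |q|²/N`); the pinned infimum is finite eventually at small
density, hard cores included (`stub_impurityEnergyFinite`, LANDED p147259); so the crux is
kernel-reduced (`cloudMomentumAtom_of_andersonFidelityOfFinite`, LANDED p147259) to ANDERSON FIDELITY
with finite energies: every pinned near-minimiser `Φ` and every free near-minimiser `Ψ` have
`|⟨Ψ,Φ⟩|² ≥ 1 − ε` (small `ρ`, eventually in `N`, slack `δ` after `N`).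

## The c2 reshape (L4: an honestly-too-big stub split into registered stubs; 5 ≤ stubs_max = 7)

Anderson fidelity for ALL near-minimiser pairs = (A) ONE good pair at every slack + (B) all free
near-minimisers are close to each other + (C) all pinned near-minimisers are close to each other,
chained by the Fubini–Study triangle inequality (`andersonFidelityOfFinite_of_clustering`: three
overlaps `≥ 1 − η` give `≥ 1 − 9η`; `η = ε/9`, `δ = min δ_free δ_imp`). B and C are fixed-`(N, L)`
spectral statements ("`∀ η ∃ δ`: `δ`-near-minimisers pairwise overlap `≥ 1 − η`" = simplicity of the
ground state of the closed form + a slack below the gap), each split once more into its PROVABLE part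
and its open part:

* `stub_fidelityPair` (A, INFRARED, the crux proper; lead): at small density, eventually in `N`, for
  EVERY slack `δ > 0` ONE pinned `δ`-near-minimiser and ONE free `δ`-near-minimiser overlap `≥ 1 − η`.
  "No static orthogonality catastrophe in the dilute interacting 3-D Bose gas" for the two ground
  states, in the tree's near-minimiser language; one loop `1 − Z ≈ 0.886 (b/a)² √(ρa³)`
  (GuentherEtAl2021 eq. (14)); no rigorous theorem in print; open-problem grade (c1 LEAD-REPORT).
* `stub_freeClustering_integrable` (B1; LANDED p150972, module `…ClusteringReduction`): free clustering for integrable `v` (`∫ v(|x|)dx < ∞`; every bounded admissible `v`), all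
  `N ≥ 1`, `L > 0` — Reed–Simon XIII.48(a) on the torus (`PeriodicGroundStateNondegenerateIntegrable_holds`)
  + the tree's clustering-from-Ky-Fan-gap lemma + the phase-to-overlap dictionary.
* `stub_freeKyFanGap_locallyBounded` (B2a; LANDED p152957, module `…FreeKyFanGapLocallyBounded`, from the
  landed HardCoreExtension machinery found by the B2 worker): for admissible `v` LOCALLY BOUNDED on `(0, ∞)` (`∀ δ > 0, v ≤ M_δ < ⊤` on
  `(δ, ∞)`: all `r^{-p}` cores, integrable or not) the Ky Fan gap `2E₀ < kyFanTwo v N L` holds at EVERY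
  `(N, L)` with `L > 2R₀` and `E₀ < ⊤` (`maxFormPositive_of_locallyBounded` + `stub_maxFormSimple_of_positive`
  + truncation convergence, namespace `…Cruxes.HardCoreExtension.ThirdLawCurrentFloorAlt`), whence in the
  small-`ρ` / eventual-`N` frame.
* `stub_freeKyFanGap_hardWall` (B2b, OPEN): the residue — admissible `v` that is neither integrable nor
  locally bounded on `(0,∞)`, i.e. carries a genuine hard wall at positive radius (hard cores `⊤·1_{[0,a]}`,
  hard shells, fat-Cantor `⊤`-sets): the Ky Fan gap at small density eventually in `N`. Faris–Simon on
  the free region `{W < ∞}` gives simplicity on each connected component and the gas sector wins over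
  confined sectors by an energy margin, so B2b ⟸ "LEMMA G" (transitivity of `S_N` on `π₀` of the dilute
  hard-sphere configuration space on the torus, eventually in `N` at small `ρb³`) — OPEN in discrete
  geometry (Baryshnikov–Bubenik–Kahle IMRN 2014 §6; sparse locally jammed packings defeat peeling) — plus
  the exotic-class residue X of the sibling crux `HardCoreExtension` (stmt-11786: `stub_lemmaGConnected`,
  `stub_essExoticTruncationGap`; landed chain `lemmaGBridge_c3 → hardCore_maxFormSimple_of_transitive →
  kyFanGap`, all taking transitivity as HYPOTHESIS; G is typed there at side `sideLength ρ N`, here the side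
  is `sideLength ρ (N+1)`). Nothing landed excludes exact energy ties of mirror-image components not
  related by a permutation (which would give `2E₀ = kyFanTwo`); no such family is known.
* `stub_impurityClustering_of_gap` (C1; LANDED p151629, module `…ImpurityClusteringOfGap`): for the pinned form, a Ky Fan gap
  (stated inline: orthogonal trial pairs cost `≥ 2E_imp + γ`) gives clustering in overlap form — the
  parallelogram-law argument of `exists_phase_integral_norm_sub_sq_le_of_kyFanGap`, verbatim for
  `impurityPeriodicEnergy v 0` (the extra one-body term obeys the same parallelogram/scaling laws).
* `stub_impurityKyFanGap` (C2, open): the Ky Fan gap of the pinned form `H_N + ∑ⱼ v^per(xⱼ)` at small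
  density eventually in `N`. Integrable `v`: Reed–Simon XIII.48(a) again (positivity-improving
  semigroup on the connected torus, Trotter with `(W + V₀) ∧ n`), standard but UNWRITTEN — the tree's
  max-form and Feynman–Kac packages (`PeriodicMaxForm*`, `PeriodicFeynmanKac*`,
  `PeriodicGroundStateNondegenerate*`) are typed for the PAIR interaction only and need a one-body
  generalisation; hard cores: Lemma G flavour again (pinned free region).

Composition (sorry-free): `freeClustering_of_stubs` (B1, B2a, B2b ⇒ B by cases on `∫ v < ∞` and on local boundedness),
`impurityClustering_of_stubs` (C1, C2 ⇒ C), the LANDED `andersonFidelityOfFinite_of_clustering`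
(A, B, C ⇒ Anderson fidelity, module `…ClusteringReduction`, p150972: Fubini–Study chaining, phase→overlap
dictionary, `freeClustering_of_kyFanGap`), `CloudMomentumAtom_of := cloudMomentumAtom_of_andersonFidelityOfFinite …`
(crux BY NAME). Open stubs after wave 2: A (`stub_fidelityPair`), B2b (`stub_freeKyFanGap_hardWall`),
C2 (`stub_impurityKyFanGap`); sorries = 3. Landed by this line: p143762, p144993, p147259 (c1); p150972 (B1 +
reduction), p151629 (C1), p152957 (B2a) (c2).
Lead c3 (skeleton v7 → v8, 2026-08-17): stub C2 split like B — `stub_impurityKyFanGap_integrable` (C2a: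
integrable `v`, every `N ≥ 1`, `L > 0`; Reed–Simon XIII.48(a) for the weight `W + V₀`) — LANDED p161553 in
this session together with the abstract-weight generalisation of the max-form package it needed (12
Literature files `PeriodicWeighted*.lean`) — and `stub_impurityKyFanGap_nonintegrable` (C2b: non-integrable
residue, eventually in `N`; locally bounded cores = the same package + the HardCoreExtension truncation
chain for the weight `W + V₀`, hard walls = Lemma G); `impurityKyFanGap_of_stubs` recombines them (cases on
`∫ v < ∞`) into the old C2, which stays a THEOREM with its registered signature. Open stubs (v8): A, B2b,
C2b; sorries = 3.
Landed by lead c3 around stub A (all `--supports`, namespace of this file): `stub_pinningBornBound`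
(p155422: `E_imp ≤ E^per + ρ∫v` for every `N` — pinning costs at most the Born term),
`stub_fidelityPairBornSlack` (p156055: A with the pinned slack inflated by the Born term holds at every
`(N, L)` with overlap 1 — the provable half of A; A = relaxation of the pinned slack below the Born scale),
`stub_scattererTermBornBound` (p156160: no pile-up at the scatterer, `∫V₀|Φ|² ≤ ρ∫v + δ`), and the
ONE-STUB ALTERNATIVE COMPOSITION `stub_cloudMomentumAtom_of_fidelityForEach` (p156285, module
`…Theorems.BECProbeMassFlowCloudMomentumAtomForEachReduction`): the "∀Φ ∃Ψ" fidelity A′ alone implies the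
crux by name (no B, no C, hence no Lemma G and no package debt on this crux); A′ ⟸ A + B + C.
Degenerate checks: `v ≡ 0` — A true (both problems free; constant state), B1 applies (`∫ 0 < ∞`),
C true (torus Laplacian), crux true; `d = 1` analogue — A false (log-divergent static exponent), as it
must be. No `Disproof.lean`, no dead lines, no Negative lemmas exist for this crux (ledger crux ls).

## Lead c4 reshape (skeleton v9, 2026-08-17): ONE registered stub, aligned with the crux's own robustness

The registered stub set is now the single infrared stub `stub_fidelityForEach` (A′, the "∀Φ ∃Ψ" Anderson
fidelity = the hypothesis of the landed one-stub composition `cloudMomentumAtom_of_fidelityForEach`, p156285),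
and `CloudMomentumAtom_of := cloudMomentumAtom_of_fidelityForEach stub_fidelityForEach`. Why (tie audit, new
w.r.t. v8): the v8 stubs B2b/C2b (Ky Fan gaps of the free / pinned forms for hard-wall `v`) FAIL under an exact
energy tie of two non-permutation-related components of the hard-wall free region (mirror-image sectors), a
scenario in which the crux itself stays TRUE (`Π₀` and the rigid translations preserve every sector, `w₀` is a
quadratic form, so tied near-minimisers inherit `w₀ ≥ 1 − 2ε`); A′ survives exactly the scenarios the crux
survives (a free-and-pinned tie: match sectors Φ ↦ Ψ; a pinned-only tie between the gas sector and a
boson-caged-by-the-scatterer sector kills A′ AND the crux, since a caged boson has `w₀ ≈ |cage|/L³`). So v8 could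
die (`stub-false` on B2b/C2b) with the crux alive, v9 cannot: its one stub is false only where the crux is. Nothing
is lost: A′ ⟸ A + B + C (`fidelityForEach_of_endpointFidelity ∘ andersonFidelityOfFinite_of_clustering`, below,
sorry-free), and for integrable or locally bounded `v` the clustering inputs B, C are LANDED (B1 p150972, B2a
p152957, C1 p151629, C2a p161553), so on that class A′ ⟸ A alone; the finer v8 split (A `stub_fidelityPair`,
B2b `stub_freeKyFanGap_hardWall`, C2b `stub_impurityKyFanGap_nonintegrable`) is kept VERBATIM below as
hypotheses of the sorry-free `CloudMomentumAtom_of_pair_and_gaps` (archived stubs; re-registrable as is).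
Cross-route (landed by c4, `…Theorems.BECProbeMassFlowCloudMomentumAtomStaticRigidityLink`): A′, hence the
crux, follows from the body of `BECSwapNoCatastrophe.TorusStaticImpurityRigidity` (stmt-14395) read at this
route's box `sideLength ρ (N + 1)` over all admissible `v` (`stub_cloudMomentumAtom_of_staticImpurityRigiditySucc`)
— the two items carry one and the same open infrared statement. Fixed-`N` certificates (landed by c4,
`…Theorems.BECProbeMassFlowCloudMomentumAtomFixedN` p165038 and `…FixedNCrux`): for integrable `v` the stub A′
VERBATIM with `∀ N, ∃ ρ₀(N)` in place of `∃ ρ₀, ∀ ρ, ∀ᶠ N` (`stub_fidelityForEach_fixedN`) and the CRUX BODY with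
`∀ N ≥ 1, ∃ ρ₀(N)` (`stub_cloudMomentumAtom_fixedN`) are THEOREMS (free torus Ky Fan gap `(2π/L)²` vs Born pinning
cost `N L⁻³∫v`); so the open content of A′ and of the crux is exactly the uniformity of `ρ₀` in `N`.
Open stubs (v9): A′ only; sorries = 1.

## Lead c5 (skeleton v10, 2026-08-17): stub set unchanged (A′ only); fixed-`N` certificate for ALL admissible `v`

No reshape: the one registered stub is still `stub_fidelityForEach` (A′) and `CloudMomentumAtom_of` is unchanged.
What c5 landed around it (all `--supports`, namespace of this file): `…Theorems.BECProbeMassFlowCloudMomentumAtomFixedNAllEnergy`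
(p167999) — **pinning one of `N + 1` bosons lowers the energy**, `E^per(N, L) ≤ E_imp(N, L, 0) ≤ E^tag_κ(N, L) ≤
E^per(N+1, L)` for every measurable `v ≥ 0`, every `κ`, `N`, `L` (`impurityPeriodicGroundStateEnergy_zero_le_tagged/_succ`,
`periodicGroundStateEnergy_le_succ`; from the landed zero-momentum attainment/descent of crux `RecoilTransfer`), a
core-vanishing `C¹` pair profile with finite `E₁, I, K` for every finite-range `v` (`exists_pairProfile_of_finiteRange`),
and `E^per(M, L) ≤ c/L²` at fixed `M` on large tori for EVERY admissible `v` (`exists_periodicGroundStateEnergy_le_div_sq`,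
via `LSSY2005_jastrowBound_holds`); `…Theorems.BECProbeMassFlowCloudMomentumAtomFixedNAll` (p168148) — c4's fixed-`N`
certificates WITHOUT the integrability hypothesis: `stub_fidelityForEach_fixedN_all` (A′ verbatim with `∀ N, ∃ ρ₀(N)`)
and `stub_cloudMomentumAtom_fixedN_all` (the CRUX BODY with `∀ N ≥ 1, ∃ ρ₀(N)`) for every repulsive finite-range `v`,
hard cores / hard shells / fat-Cantor `⊤`-sets / non-integrable walls included (at fixed `N` the whole pinned problem
sits within `o(L⁻²)` of `E^per(N)`, below the free Ky Fan gap `2π²/L²`). So over the ENTIRE admissible class the crux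
differs from a kernel-checked theorem exactly by the uniformity of `ρ₀` in `N`; c5 concurs with c1–c4 that this
uniformity (healing at `ξ = (8πρa)^{-1/2}` in the thermodynamic limit) is the crux proper and open-problem grade.
-/

noncomputable section

open MeasureTheory Filter
open scoped ENNReal NNReal ComplexConjugate BigOperators InnerProductSpace

namespace Summit.AtomisticToContinuum.BoseEinsteinCondensation.Cruxes.CloudMomentumAtom.Birth

open Literature.MathematicalPhysics.QuantumManyBody.BoseGas
open Summit.AtomisticToContinuum.BoseEinsteinCondensation.Theses.BECProbeMassFlow

/-! ## The registered stub (v9: `sorry` only here)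

Conventions: inside `∀ᶠ N` the torus side is bound equationally, `∀ L, L = sideLength ρ (N + 1) → …`
(instantiated with `rfl`); `⟨Ψ, Φ⟩ = ∫_{cell^N} conj Ψ · Φ` (Bochner, `ℂ`); overlaps are stated as
`ENNReal.ofReal (1 - ε) ≤ (‖⟨Ψ, Φ⟩‖₊ : ℝ≥0∞) ^ 2`, the shape of this line's landed stubs. -/

/-- **Stub A′ — "∀Φ ∃Ψ" Anderson fidelity: no static orthogonality catastrophe (INFRARED; size XL; the
crux proper; the ONLY registered stub of v9).** For every repulsive finite-range `v` and `ε > 0` there is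
`ρ₀ > 0` such that for `0 < ρ < ρ₀`, eventually in `N`, on the torus of side `L = sideLength ρ (N + 1)` with
finite free and pinned infima, for every free slack `δ₂ > 0` there is a pinned slack `δ₁ > 0` such that EVERY
`δ₁`-near-minimiser `Φ` of the pinned-scatterer energy (scatterer at the origin) has SOME free
`δ₂`-near-minimiser `Ψ` with `1 − ε ≤ |⟨Ψ, Φ⟩|²`. Ground-state reading (simple ground states `χ_imp`, `χ_free`,
slack below the gaps): the fidelity `Z_N(ρ) = |⟨χ_free, χ_imp⟩|²` tends to `1` as `ρ → 0` UNIFORMLY in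
`N ≥ N₀(ρ)` — physically `1 − Z ≈ 0.886 (b/a)² √(ρa³)` at one loop, `(ρ/2)∫d³k(2π)⁻³|v̂_k|²k²/ω_k³`, finite in
`d = 3` only because the bath heals at `ξ = (8πρa)^{-1/2}` (`S(k) ≈ k/2c`); the IDEAL bath has
`log Z₀ ≍ −ρ b² L → −∞` (GuentherEtAl2021 eqs. (3), (14)). Equivalent open statements: the relative variance
of the ground-state transform `g = χ_imp/χ_free` under `χ_free²` (`1 − Z = Var g / E[g²]`), the
integrability of `β ↦ β·Cov(W(X_0), W(X_β))` for the impurity potential `W = ∑ⱼ v(xⱼ)` along the stationary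
ground-state diffusion of the free gas (`χ_F = ∫₀^∞ β C_W(β) dβ`; `C_W ∼ β^{-4}` interacting vs `β^{-3/2}`
ideal), or `sup_s χ_F(s) → 0` along `H_N + sW` — all of them N-uniform second-negative-moment control of the
density fluctuations of the dilute gas at the scale of the healing length, logically incomparable with and not
implied by (even complete) BEC. The same statement, at box `sideLength ρ N` and for bounded `v`, is the crux
`BECSwapNoCatastrophe.TorusStaticImpurityRigidity` (stmt-14395); its `(N+1)`-box, all-`v` reading implies this
stub and the crux (`stub_cloudMomentumAtom_of_staticImpurityRigiditySucc`, landed by c4). No rigorous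
(no-)orthogonality-catastrophe theorem for a static scatterer in the dilute interacting 3-D Bose gas exists in
print. [cite: GuentherEtAl2021, eqs. (3), (8), (14); Anderson1967; GebertKuttlerMuller2014;
MysliwySeiringer2020; LSSY2005 App. A] -/
theorem stub_fidelityForEach :
    ∀ (v : ℝ → ℝ≥0∞), IsRepulsiveFiniteRange v → ∀ ε : ℝ, 0 < ε →
      ∃ ρ₀ : ℝ, 0 < ρ₀ ∧ ∀ ρ : ℝ, 0 < ρ → ρ < ρ₀ → ∀ᶠ N : ℕ in atTop,
        ∀ L : ℝ, L = sideLength ρ (N + 1) →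
          periodicGroundStateEnergy v N L ≠ ⊤ →
          impurityPeriodicGroundStateEnergy v N L 0 ≠ ⊤ →
          ∀ δ₂ : ℝ≥0∞, 0 < δ₂ → ∃ δ₁ : ℝ≥0∞, 0 < δ₁ ∧
            ∀ Φ : PeriodicTrialState N L,
              impurityPeriodicEnergy v 0 Φ ≤ impurityPeriodicGroundStateEnergy v N L 0 + δ₁ →
              ∃ Ψ : PeriodicTrialState N L,
                periodicEnergy v Ψ ≤ periodicGroundStateEnergy v N L + δ₂ ∧
                ENNReal.ofReal (1 - ε) ≤
                  (‖∫ X in cellN N L, conj (Ψ.ψ X) * Φ.ψ X‖₊ : ℝ≥0∞) ^ 2 := by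
  sorry

/-- **The skeleton theorem (v9)**: the single registered stub `stub_fidelityForEach` (A′) implies the crux
`Summit.AtomisticToContinuum.BoseEinsteinCondensation.Theses.BECProbeMassFlow.CloudMomentumAtom`, concluded BY
NAME, through the landed one-stub composition `cloudMomentumAtom_of_fidelityForEach` (p156285; it carries the
landed stubs `stub_freeZeroMomentum` p143762, `stub_projectionTransfer` p144993, `stub_impurityEnergyFinite`
p147259). `sorry` enters only through the stub. [folklore] -/
theorem CloudMomentumAtom_of : CloudMomentumAtom :=
  cloudMomentumAtom_of_fidelityForEach stub_fidelityForEach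

/-! ## Archived finer split (v8: A + B2b + C2b), kept sorry-free as explicit hypotheses

The v8 stubs are reproduced VERBATIM as the hypotheses `hA`, `hB2b`, `hC2b` below (re-registrable as they
stand); the landed pieces B1 (p150972), B2a (p152957), C1 (p151629), C2a (p161553) and the case splits
`freeClustering_of_stubs`, `impurityKyFanGap_of_stubs`, `impurityClustering_of_stubs` recombine them, and
`andersonFidelityOfFinite_of_clustering` (p150972, Fubini–Study chaining) yields the "∀Φ ∀Ψ" endpoint
fidelity, which implies A′ (`fidelityForEach_of_endpointFidelity`) and the crux
(`CloudMomentumAtom_of_pair_and_gaps`). Archived docstrings (abridged):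
* A `stub_fidelityPair` — ONE good pair at every slack: `∃Φ ∃Ψ` near-minimisers with overlap `≥ 1 − η`
  (weakest, tie-proof form of the fidelity; provable half LANDED as `stub_fidelityPairBornSlack` p156055:
  overlap 1 at pinned slack `δ + ρ∫v`; the residue is the relaxation of the pinned slack below the Born scale).
* B2b `stub_freeKyFanGap_hardWall` — Ky Fan gap of the free form for `v` neither integrable nor locally
  bounded on `(0,∞)` (hard walls at positive radius): Faris–Simon per component of the free region + "Lemma G"
  (S_N-transitivity on `π₀` of the dilute hard-sphere configuration space of the torus; open in discrete
  geometry, shared with HardCoreExtension stmt-11786; conditional shape LANDED as `kyFanGap_hardCore_of_transitive`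
  p152957); FALSE under an exact tie of mirror-image components (not a failure of the crux).
* C2b `stub_impurityKyFanGap_nonintegrable` — Ky Fan gap of the pinned form for non-integrable `v`:
  locally bounded cores = transport of the HardCoreExtension truncation chain to the weight `W + V₀`
  (library debt, ≈ 25 files), hard walls = Lemma G for the pinned free region; same tie caveat.
[cite: ReedSimonIV1978, §XIII.12 Thms XIII.43–XIII.48; FarisSimon1975, Thm 1] -/

/-- **C2 (Ky Fan gap of the pinned form over the whole admissible class) from C2a and C2b**: by cases
on `∫ v(|x|) dx < ∞` — integrable: C2a at every `N ≥ 1`, `L = sideLength ρ (N + 1) > 0` (any `ρ₀`, here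
`1`; the finiteness hypothesis is not even needed); non-integrable: C2b verbatim. [folklore] -/
theorem impurityKyFanGap_of_stubs
    (hC2a : ∀ (v : ℝ → ℝ≥0∞), IsRepulsiveFiniteRange v → (∫⁻ x : Space, v ‖x‖) ≠ ⊤ →
      ∀ (N : ℕ) (L : ℝ), 1 ≤ N → 0 < L →
        ∃ γ : ℝ, 0 < γ ∧ ∀ Φ₁ Φ₂ : PeriodicTrialState N L,
          ∫ X in cellN N L, conj (Φ₁.ψ X) * Φ₂.ψ X = 0 →
          2 * impurityPeriodicGroundStateEnergy v N L 0 + ENNReal.ofReal γ ≤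
            impurityPeriodicEnergy v 0 Φ₁ + impurityPeriodicEnergy v 0 Φ₂)
    (hC2b : ∀ (v : ℝ → ℝ≥0∞), IsRepulsiveFiniteRange v → (∫⁻ x : Space, v ‖x‖) = ⊤ →
      ∃ ρ₀ : ℝ, 0 < ρ₀ ∧ ∀ ρ : ℝ, 0 < ρ → ρ < ρ₀ → ∀ᶠ N : ℕ in atTop,
        ∀ L : ℝ, L = sideLength ρ (N + 1) →
          impurityPeriodicGroundStateEnergy v N L 0 ≠ ⊤ →
          ∃ γ : ℝ, 0 < γ ∧ ∀ Φ₁ Φ₂ : PeriodicTrialState N L,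
            ∫ X in cellN N L, conj (Φ₁.ψ X) * Φ₂.ψ X = 0 →
            2 * impurityPeriodicGroundStateEnergy v N L 0 + ENNReal.ofReal γ ≤
              impurityPeriodicEnergy v 0 Φ₁ + impurityPeriodicEnergy v 0 Φ₂) :
    ∀ (v : ℝ → ℝ≥0∞), IsRepulsiveFiniteRange v →
      ∃ ρ₀ : ℝ, 0 < ρ₀ ∧ ∀ ρ : ℝ, 0 < ρ → ρ < ρ₀ → ∀ᶠ N : ℕ in atTop,
        ∀ L : ℝ, L = sideLength ρ (N + 1) →
          impurityPeriodicGroundStateEnergy v N L 0 ≠ ⊤ →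
          ∃ γ : ℝ, 0 < γ ∧ ∀ Φ₁ Φ₂ : PeriodicTrialState N L,
            ∫ X in cellN N L, conj (Φ₁.ψ X) * Φ₂.ψ X = 0 →
            2 * impurityPeriodicGroundStateEnergy v N L 0 + ENNReal.ofReal γ ≤
              impurityPeriodicEnergy v 0 Φ₁ + impurityPeriodicEnergy v 0 Φ₂ := by
  intro v hv
  by_cases hint : (∫⁻ x : Space, v ‖x‖) = ⊤
  · exact hC2b v hv hint
  · refine ⟨1, one_pos, fun ρ hρ _ => ?_⟩
    filter_upwards [eventually_ge_atTop 1] with N hN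
    intro L hL _
    have hLpos : 0 < L := by
      rw [hL]
      unfold sideLength
      exact Real.rpow_pos_of_pos (div_pos (by exact_mod_cast Nat.succ_pos N) hρ) _
    exact hC2a v hv hint N L hN hLpos

/-! ### Case splits `B1, B2a, B2b ⇒ B` and `C1, C2 ⇒ C` (sorry-free, unchanged from v8) -/

/-- **Free clustering (stub B of the conceptual split) from B1, B2a, B2b**: by cases on
`∫ v(|x|)dx < ∞` — integrable: B1 at every `N ≥ 1`, `L = sideLength ρ (N+1) > 0` (any `ρ₀`, here `1`);
non-integrable: the Ky Fan gap of B2a (locally bounded class) or B2b (hard walls), read through the landed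
`freeClustering_of_kyFanGap`. [folklore] -/
theorem freeClustering_of_stubs
    (hB1 : ∀ (v : ℝ → ℝ≥0∞), IsRepulsiveFiniteRange v → (∫⁻ x : Space, v ‖x‖) ≠ ⊤ →
      ∀ (N : ℕ) (L : ℝ), 1 ≤ N → 0 < L →
        ∀ η : ℝ, 0 < η → ∃ δ : ℝ≥0∞, 0 < δ ∧
          ∀ Ψ Ψ' : PeriodicTrialState N L,
            periodicEnergy v Ψ ≤ periodicGroundStateEnergy v N L + δ →
            periodicEnergy v Ψ' ≤ periodicGroundStateEnergy v N L + δ →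
            ENNReal.ofReal (1 - η) ≤
              (‖∫ X in cellN N L, conj (Ψ.ψ X) * Ψ'.ψ X‖₊ : ℝ≥0∞) ^ 2)
    (hB2a : ∀ (v : ℝ → ℝ≥0∞), IsRepulsiveFiniteRange v →
      (∀ δ : ℝ, 0 < δ → ∃ M : ℝ≥0∞, M ≠ ⊤ ∧ ∀ r : ℝ, δ < r → v r ≤ M) →
      ∃ ρ₀ : ℝ, 0 < ρ₀ ∧ ∀ ρ : ℝ, 0 < ρ → ρ < ρ₀ → ∀ᶠ N : ℕ in atTop,
        ∀ L : ℝ, L = sideLength ρ (N + 1) →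
          periodicGroundStateEnergy v N L ≠ ⊤ →
          2 * periodicGroundStateEnergy v N L < kyFanTwo v N L)
    (hB2b : ∀ (v : ℝ → ℝ≥0∞), IsRepulsiveFiniteRange v → (∫⁻ x : Space, v ‖x‖) = ⊤ →
      (¬ ∀ δ : ℝ, 0 < δ → ∃ M : ℝ≥0∞, M ≠ ⊤ ∧ ∀ r : ℝ, δ < r → v r ≤ M) →
      ∃ ρ₀ : ℝ, 0 < ρ₀ ∧ ∀ ρ : ℝ, 0 < ρ → ρ < ρ₀ → ∀ᶠ N : ℕ in atTop,
        ∀ L : ℝ, L = sideLength ρ (N + 1) →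
          periodicGroundStateEnergy v N L ≠ ⊤ →
          2 * periodicGroundStateEnergy v N L < kyFanTwo v N L) :
    ∀ (v : ℝ → ℝ≥0∞), IsRepulsiveFiniteRange v →
      ∃ ρ₀ : ℝ, 0 < ρ₀ ∧ ∀ ρ : ℝ, 0 < ρ → ρ < ρ₀ → ∀ᶠ N : ℕ in atTop,
        ∀ L : ℝ, L = sideLength ρ (N + 1) →
          periodicGroundStateEnergy v N L ≠ ⊤ →
          ∀ η : ℝ, 0 < η → ∃ δ : ℝ≥0∞, 0 < δ ∧
            ∀ Ψ Ψ' : PeriodicTrialState N L,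
              periodicEnergy v Ψ ≤ periodicGroundStateEnergy v N L + δ →
              periodicEnergy v Ψ' ≤ periodicGroundStateEnergy v N L + δ →
              ENNReal.ofReal (1 - η) ≤
                (‖∫ X in cellN N L, conj (Ψ.ψ X) * Ψ'.ψ X‖₊ : ℝ≥0∞) ^ 2 := by
  intro v hv
  by_cases hint : (∫⁻ x : Space, v ‖x‖) = ⊤
  · -- non-integrable: Ky Fan gap from B2a (locally bounded class) or B2b (hard walls)
    obtain ⟨ρ₀, hρ₀, H⟩ : ∃ ρ₀ : ℝ, 0 < ρ₀ ∧ ∀ ρ : ℝ, 0 < ρ → ρ < ρ₀ → ∀ᶠ N : ℕ in atTop,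
        ∀ L : ℝ, L = sideLength ρ (N + 1) → periodicGroundStateEnergy v N L ≠ ⊤ →
          2 * periodicGroundStateEnergy v N L < kyFanTwo v N L := by
      by_cases hlb : ∀ δ : ℝ, 0 < δ → ∃ M : ℝ≥0∞, M ≠ ⊤ ∧ ∀ r : ℝ, δ < r → v r ≤ M
      · exact hB2a v hv hlb
      · exact hB2b v hv hint hlb
    refine ⟨ρ₀, hρ₀, fun ρ hρ hρlt => ?_⟩
    filter_upwards [H ρ hρ hρlt] with N hN
    intro L hL hE η hη
    exact freeClustering_of_kyFanGap hv.1 hE (hN L hL hE) hη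
  · refine ⟨1, one_pos, fun ρ hρ _ => ?_⟩
    filter_upwards [eventually_ge_atTop 1] with N hN
    intro L hL _ η hη
    have hLpos : 0 < L := by
      rw [hL]
      unfold sideLength
      exact Real.rpow_pos_of_pos (div_pos (by exact_mod_cast Nat.succ_pos N) hρ) _
    exact hB1 v hv hint N L hN hLpos η hη

/-- **Pinned clustering (stub C of the conceptual split) from C1 and C2**: C2 supplies the Ky Fan gap
of the pinned form eventually in `N` at small density, C1 turns it into clustering. [folklore] -/
theorem impurityClustering_of_stubs
    (hC1 : ∀ (v : ℝ → ℝ≥0∞), Measurable v → ∀ (N : ℕ) (L : ℝ),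
      impurityPeriodicGroundStateEnergy v N L 0 ≠ ⊤ →
      ∀ γ : ℝ, 0 < γ →
        (∀ Φ₁ Φ₂ : PeriodicTrialState N L,
          ∫ X in cellN N L, conj (Φ₁.ψ X) * Φ₂.ψ X = 0 →
          2 * impurityPeriodicGroundStateEnergy v N L 0 + ENNReal.ofReal γ ≤
            impurityPeriodicEnergy v 0 Φ₁ + impurityPeriodicEnergy v 0 Φ₂) →
        ∀ η : ℝ, 0 < η → ∃ δ : ℝ≥0∞, 0 < δ ∧
          ∀ Φ Φ' : PeriodicTrialState N L,
            impurityPeriodicEnergy v 0 Φ ≤ impurityPeriodicGroundStateEnergy v N L 0 + δ →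
            impurityPeriodicEnergy v 0 Φ' ≤ impurityPeriodicGroundStateEnergy v N L 0 + δ →
            ENNReal.ofReal (1 - η) ≤
              (‖∫ X in cellN N L, conj (Φ.ψ X) * Φ'.ψ X‖₊ : ℝ≥0∞) ^ 2)
    (hC2 : ∀ (v : ℝ → ℝ≥0∞), IsRepulsiveFiniteRange v →
      ∃ ρ₀ : ℝ, 0 < ρ₀ ∧ ∀ ρ : ℝ, 0 < ρ → ρ < ρ₀ → ∀ᶠ N : ℕ in atTop,
        ∀ L : ℝ, L = sideLength ρ (N + 1) →
          impurityPeriodicGroundStateEnergy v N L 0 ≠ ⊤ →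
          ∃ γ : ℝ, 0 < γ ∧ ∀ Φ₁ Φ₂ : PeriodicTrialState N L,
            ∫ X in cellN N L, conj (Φ₁.ψ X) * Φ₂.ψ X = 0 →
            2 * impurityPeriodicGroundStateEnergy v N L 0 + ENNReal.ofReal γ ≤
              impurityPeriodicEnergy v 0 Φ₁ + impurityPeriodicEnergy v 0 Φ₂) :
    ∀ (v : ℝ → ℝ≥0∞), IsRepulsiveFiniteRange v →
      ∃ ρ₀ : ℝ, 0 < ρ₀ ∧ ∀ ρ : ℝ, 0 < ρ → ρ < ρ₀ → ∀ᶠ N : ℕ in atTop,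
        ∀ L : ℝ, L = sideLength ρ (N + 1) →
          impurityPeriodicGroundStateEnergy v N L 0 ≠ ⊤ →
          ∀ η : ℝ, 0 < η → ∃ δ : ℝ≥0∞, 0 < δ ∧
            ∀ Φ Φ' : PeriodicTrialState N L,
              impurityPeriodicEnergy v 0 Φ ≤ impurityPeriodicGroundStateEnergy v N L 0 + δ →
              impurityPeriodicEnergy v 0 Φ' ≤ impurityPeriodicGroundStateEnergy v N L 0 + δ →
              ENNReal.ofReal (1 - η) ≤
                (‖∫ X in cellN N L, conj (Φ.ψ X) * Φ'.ψ X‖₊ : ℝ≥0∞) ^ 2 := by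
  intro v hv
  obtain ⟨ρ₀, hρ₀, H⟩ := hC2 v hv
  refine ⟨ρ₀, hρ₀, fun ρ hρ hρlt => ?_⟩
  filter_upwards [H ρ hρ hρlt] with N hN
  intro L hL hEimp η hη
  obtain ⟨γ, hγ, hgap⟩ := hN L hL hEimp
  exact hC1 v hv.1 N L hEimp γ hγ hgap η hη

/-- **Endpoint fidelity ⇒ A′**: the "∀Φ ∀Ψ" endpoint fidelity (one slack `δ` after `N` such that every
pinned `δ`-near-minimiser and every free `δ`-near-minimiser overlap `≥ 1 − ε`) implies the registered
"∀Φ ∃Ψ" stub shape — answer the free slack `δ₂` with the pinned slack `min δ δ₂` and, for each `Φ`, with any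
free `min δ δ₂`-near-minimiser (one exists because `E^per < ⊤`). [folklore] -/
theorem fidelityForEach_of_endpointFidelity
    (hE : ∀ (v : ℝ → ℝ≥0∞), IsRepulsiveFiniteRange v → ∀ ε : ℝ, 0 < ε →
      ∃ ρ₀ : ℝ, 0 < ρ₀ ∧ ∀ ρ : ℝ, 0 < ρ → ρ < ρ₀ → ∀ᶠ N : ℕ in atTop,
        ∀ L : ℝ, L = sideLength ρ (N + 1) →
          periodicGroundStateEnergy v N L ≠ ⊤ →
          impurityPeriodicGroundStateEnergy v N L 0 ≠ ⊤ →
          ∃ δ : ℝ≥0∞, 0 < δ ∧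
            ∀ Φ : PeriodicTrialState N L,
              impurityPeriodicEnergy v 0 Φ ≤ impurityPeriodicGroundStateEnergy v N L 0 + δ →
            ∀ Ψ : PeriodicTrialState N L,
              periodicEnergy v Ψ ≤ periodicGroundStateEnergy v N L + δ →
              ENNReal.ofReal (1 - ε) ≤
                (‖∫ X in cellN N L, conj (Ψ.ψ X) * Φ.ψ X‖₊ : ℝ≥0∞) ^ 2) :
    ∀ (v : ℝ → ℝ≥0∞), IsRepulsiveFiniteRange v → ∀ ε : ℝ, 0 < ε →
      ∃ ρ₀ : ℝ, 0 < ρ₀ ∧ ∀ ρ : ℝ, 0 < ρ → ρ < ρ₀ → ∀ᶠ N : ℕ in atTop,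
        ∀ L : ℝ, L = sideLength ρ (N + 1) →
          periodicGroundStateEnergy v N L ≠ ⊤ →
          impurityPeriodicGroundStateEnergy v N L 0 ≠ ⊤ →
          ∀ δ₂ : ℝ≥0∞, 0 < δ₂ → ∃ δ₁ : ℝ≥0∞, 0 < δ₁ ∧
            ∀ Φ : PeriodicTrialState N L,
              impurityPeriodicEnergy v 0 Φ ≤ impurityPeriodicGroundStateEnergy v N L 0 + δ₁ →
              ∃ Ψ : PeriodicTrialState N L,
                periodicEnergy v Ψ ≤ periodicGroundStateEnergy v N L + δ₂ ∧
                ENNReal.ofReal (1 - ε) ≤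
                  (‖∫ X in cellN N L, conj (Ψ.ψ X) * Φ.ψ X‖₊ : ℝ≥0∞) ^ 2 := by
  intro v hv ε hε
  obtain ⟨ρ₀, hρ₀, H⟩ := hE v hv ε hε
  refine ⟨ρ₀, hρ₀, fun ρ hρ hρlt => ?_⟩
  filter_upwards [H ρ hρ hρlt] with N hN
  intro L hL hEper hEimp δ₂ hδ₂
  obtain ⟨δ, hδ, K⟩ := hN L hL hEper hEimp
  refine ⟨min δ δ₂, lt_min hδ hδ₂, fun Φ hΦ => ?_⟩
  have hlt : periodicGroundStateEnergy v N L < periodicGroundStateEnergy v N L + min δ δ₂ :=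
    ENNReal.lt_add_right hEper (lt_min hδ hδ₂).ne'
  obtain ⟨Ψ, hΨ⟩ := iInf_lt_iff.1 hlt
  refine ⟨Ψ, hΨ.le.trans (add_le_add le_rfl (min_le_right _ _)), ?_⟩
  exact K Φ (hΦ.trans (add_le_add le_rfl (min_le_left _ _))) Ψ
    (hΨ.le.trans (add_le_add le_rfl (min_le_left _ _)))

/-- **Archived v8 composition, sorry-free: A + B2b + C2b ⇒ A′.** The three v8 stubs, VERBATIM as hypotheses
(`hA` = `stub_fidelityPair`, `hB2b` = `stub_freeKyFanGap_hardWall`, `hC2b` = `stub_impurityKyFanGap_nonintegrable`),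
together with the landed B1, B2a, C1, C2a, give the endpoint fidelity (`andersonFidelityOfFinite_of_clustering`,
p150972) and hence the registered stub A′. [folklore] -/
theorem fidelityForEach_of_pair_and_gaps
    (hA : ∀ (v : ℝ → ℝ≥0∞), IsRepulsiveFiniteRange v → ∀ η : ℝ, 0 < η →
      ∃ ρ₀ : ℝ, 0 < ρ₀ ∧ ∀ ρ : ℝ, 0 < ρ → ρ < ρ₀ → ∀ᶠ N : ℕ in atTop,
        ∀ L : ℝ, L = sideLength ρ (N + 1) →
          periodicGroundStateEnergy v N L ≠ ⊤ →
          impurityPeriodicGroundStateEnergy v N L 0 ≠ ⊤ →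
          ∀ δ : ℝ≥0∞, 0 < δ →
            ∃ Φ : PeriodicTrialState N L,
              impurityPeriodicEnergy v 0 Φ ≤ impurityPeriodicGroundStateEnergy v N L 0 + δ ∧
            ∃ Ψ : PeriodicTrialState N L,
              periodicEnergy v Ψ ≤ periodicGroundStateEnergy v N L + δ ∧
              ENNReal.ofReal (1 - η) ≤
                (‖∫ X in cellN N L, conj (Ψ.ψ X) * Φ.ψ X‖₊ : ℝ≥0∞) ^ 2)
    (hB2b : ∀ (v : ℝ → ℝ≥0∞), IsRepulsiveFiniteRange v → (∫⁻ x : Space, v ‖x‖) = ⊤ →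
      (¬ ∀ δ : ℝ, 0 < δ → ∃ M : ℝ≥0∞, M ≠ ⊤ ∧ ∀ r : ℝ, δ < r → v r ≤ M) →
      ∃ ρ₀ : ℝ, 0 < ρ₀ ∧ ∀ ρ : ℝ, 0 < ρ → ρ < ρ₀ → ∀ᶠ N : ℕ in atTop,
        ∀ L : ℝ, L = sideLength ρ (N + 1) →
          periodicGroundStateEnergy v N L ≠ ⊤ →
          2 * periodicGroundStateEnergy v N L < kyFanTwo v N L)
    (hC2b : ∀ (v : ℝ → ℝ≥0∞), IsRepulsiveFiniteRange v → (∫⁻ x : Space, v ‖x‖) = ⊤ →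
      ∃ ρ₀ : ℝ, 0 < ρ₀ ∧ ∀ ρ : ℝ, 0 < ρ → ρ < ρ₀ → ∀ᶠ N : ℕ in atTop,
        ∀ L : ℝ, L = sideLength ρ (N + 1) →
          impurityPeriodicGroundStateEnergy v N L 0 ≠ ⊤ →
          ∃ γ : ℝ, 0 < γ ∧ ∀ Φ₁ Φ₂ : PeriodicTrialState N L,
            ∫ X in cellN N L, conj (Φ₁.ψ X) * Φ₂.ψ X = 0 →
            2 * impurityPeriodicGroundStateEnergy v N L 0 + ENNReal.ofReal γ ≤
              impurityPeriodicEnergy v 0 Φ₁ + impurityPeriodicEnergy v 0 Φ₂) :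
    ∀ (v : ℝ → ℝ≥0∞), IsRepulsiveFiniteRange v → ∀ ε : ℝ, 0 < ε →
      ∃ ρ₀ : ℝ, 0 < ρ₀ ∧ ∀ ρ : ℝ, 0 < ρ → ρ < ρ₀ → ∀ᶠ N : ℕ in atTop,
        ∀ L : ℝ, L = sideLength ρ (N + 1) →
          periodicGroundStateEnergy v N L ≠ ⊤ →
          impurityPeriodicGroundStateEnergy v N L 0 ≠ ⊤ →
          ∀ δ₂ : ℝ≥0∞, 0 < δ₂ → ∃ δ₁ : ℝ≥0∞, 0 < δ₁ ∧
            ∀ Φ : PeriodicTrialState N L,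
              impurityPeriodicEnergy v 0 Φ ≤ impurityPeriodicGroundStateEnergy v N L 0 + δ₁ →
              ∃ Ψ : PeriodicTrialState N L,
                periodicEnergy v Ψ ≤ periodicGroundStateEnergy v N L + δ₂ ∧
                ENNReal.ofReal (1 - ε) ≤
                  (‖∫ X in cellN N L, conj (Ψ.ψ X) * Φ.ψ X‖₊ : ℝ≥0∞) ^ 2 :=
  fidelityForEach_of_endpointFidelity
    (andersonFidelityOfFinite_of_clustering hA
      (freeClustering_of_stubs stub_freeClustering_integrable stub_freeKyFanGap_locallyBounded hB2b)
      (impurityClustering_of_stubs stub_impurityClustering_of_gap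
        (impurityKyFanGap_of_stubs stub_impurityKyFanGap_integrable hC2b)))

/-- **Archived v8 composition, sorry-free: A + B2b + C2b ⇒ the crux by name** (through v9's
`cloudMomentumAtom_of_fidelityForEach`; equivalently through c1's `cloudMomentumAtom_of_andersonFidelityOfFinite`).
[folklore] -/
theorem CloudMomentumAtom_of_pair_and_gaps
    (hA : ∀ (v : ℝ → ℝ≥0∞), IsRepulsiveFiniteRange v → ∀ η : ℝ, 0 < η →
      ∃ ρ₀ : ℝ, 0 < ρ₀ ∧ ∀ ρ : ℝ, 0 < ρ → ρ < ρ₀ → ∀ᶠ N : ℕ in atTop,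
        ∀ L : ℝ, L = sideLength ρ (N + 1) →
          periodicGroundStateEnergy v N L ≠ ⊤ →
          impurityPeriodicGroundStateEnergy v N L 0 ≠ ⊤ →
          ∀ δ : ℝ≥0∞, 0 < δ →
            ∃ Φ : PeriodicTrialState N L,
              impurityPeriodicEnergy v 0 Φ ≤ impurityPeriodicGroundStateEnergy v N L 0 + δ ∧
            ∃ Ψ : PeriodicTrialState N L,
              periodicEnergy v Ψ ≤ periodicGroundStateEnergy v N L + δ ∧
              ENNReal.ofReal (1 - η) ≤
                (‖∫ X in cellN N L, conj (Ψ.ψ X) * Φ.ψ X‖₊ : ℝ≥0∞) ^ 2)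
    (hB2b : ∀ (v : ℝ → ℝ≥0∞), IsRepulsiveFiniteRange v → (∫⁻ x : Space, v ‖x‖) = ⊤ →
      (¬ ∀ δ : ℝ, 0 < δ → ∃ M : ℝ≥0∞, M ≠ ⊤ ∧ ∀ r : ℝ, δ < r → v r ≤ M) →
      ∃ ρ₀ : ℝ, 0 < ρ₀ ∧ ∀ ρ : ℝ, 0 < ρ → ρ < ρ₀ → ∀ᶠ N : ℕ in atTop,
        ∀ L : ℝ, L = sideLength ρ (N + 1) →
          periodicGroundStateEnergy v N L ≠ ⊤ →
          2 * periodicGroundStateEnergy v N L < kyFanTwo v N L)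
    (hC2b : ∀ (v : ℝ → ℝ≥0∞), IsRepulsiveFiniteRange v → (∫⁻ x : Space, v ‖x‖) = ⊤ →
      ∃ ρ₀ : ℝ, 0 < ρ₀ ∧ ∀ ρ : ℝ, 0 < ρ → ρ < ρ₀ → ∀ᶠ N : ℕ in atTop,
        ∀ L : ℝ, L = sideLength ρ (N + 1) →
          impurityPeriodicGroundStateEnergy v N L 0 ≠ ⊤ →
          ∃ γ : ℝ, 0 < γ ∧ ∀ Φ₁ Φ₂ : PeriodicTrialState N L,
            ∫ X in cellN N L, conj (Φ₁.ψ X) * Φ₂.ψ X = 0 →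
            2 * impurityPeriodicGroundStateEnergy v N L 0 + ENNReal.ofReal γ ≤
              impurityPeriodicEnergy v 0 Φ₁ + impurityPeriodicEnergy v 0 Φ₂) :
    CloudMomentumAtom :=
  cloudMomentumAtom_of_fidelityForEach (fidelityForEach_of_pair_and_gaps hA hB2b hC2b)

end Summit.AtomisticToContinuum.BoseEinsteinCondensation.Cruxes.CloudMomentumAtom.Birth

end
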